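import Summits.Ventures.Crystal3D.Theorems.StickyWulffConstantStackingLiminfTwelveSlots
import HarnessLib

/-!
# Unmatched centres per bond class ≤ vacant slots (helper toward `StackingLiminf`, stmt-Ventures-19145;
# counting half of S1 of stub (B) `MollifiedUpper`, line LayerChain v4)

Cell `crystal3d-full`, venture `Summits/Ventures/Crystal3D`.  BLUEPRINT-v4B (S1) applies the sharp
triangle inequality `rung_sum_translate_sub_l1` (p504959) per BOND CLASS: for layer `k` and an in-layer
vector `aVec m` compare the translated layer `x(L_k) + aVec m` with `x(L_k)`; for the gap `k → k+1` compare
`x(L_k) + b_{σ k, m}` with `x(L_{k+1})`.  The unmatched centres of these comparisons are VACANT neighbour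
slots, each (ball, slot) pair being used by at most one class, so summed over any set of layers and the
three vectors of each family they number at most `12 N − 2·numContacts x = 2D`
(`sum_classUnmatched_le`).  With `∫ bump K = 1/√2` (R1, p507991) this is exactly
`Σ_classes ‖v_k(· − c) − v_{k'}‖₁ ≤ √2·D`, the exact-constant front end of stub (B).
Ingredients: `…TwelveVectors.lean` (p509692), `…TwelveSlots.lean` (coordination + vacant = 12).
WHAT THIS IS NOT: the `L¹` estimate; pure bookkeeping.
-/

noncomputable section

namespace Summit.Ventures.Crystal3D.Theorems

open Set
open Literature.MathematicalPhysics.StatisticalMechanics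
open Summit.Ventures.Crystal3D.LayerChain (aVec bPlus bMinus)

/-- If four images of `Fin 3` have a union of `12` elements, a filtered count over the union splits into
the four filtered counts over `Fin 3` (the images are disjoint and the maps injective). -/
theorem card_filter_union_four {α : Type*} [DecidableEq α] (f₁ f₂ f₃ f₄ : Fin 3 → α) (P : α → Prop)
    [DecidablePred P]
    (h12 : (Finset.univ.image f₁ ∪ Finset.univ.image f₂ ∪ Finset.univ.image f₃ ∪
      Finset.univ.image f₄).card = 12) :
    ((Finset.univ.image f₁ ∪ Finset.univ.image f₂ ∪ Finset.univ.image f₃ ∪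
        Finset.univ.image f₄).filter P).card =
      (Finset.univ.filter fun m => P (f₁ m)).card + (Finset.univ.filter fun m => P (f₂ m)).card +
        (Finset.univ.filter fun m => P (f₃ m)).card + (Finset.univ.filter fun m => P (f₄ m)).card := by
  have h3 : ∀ g : Fin 3 → α, (Finset.univ.image g).card ≤ 3 := fun g =>
    Finset.card_image_le.trans (by simp)
  have hA := h3 f₁; have hB := h3 f₂; have hC := h3 f₃; have hD := h3 f₄
  have hU1 := Finset.card_union_le (Finset.univ.image f₁) (Finset.univ.image f₂)
  have hU2 := Finset.card_union_le (Finset.univ.image f₁ ∪ Finset.univ.image f₂) (Finset.univ.image f₃)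
  have hU3 := Finset.card_union_le (Finset.univ.image f₁ ∪ Finset.univ.image f₂ ∪ Finset.univ.image f₃)
    (Finset.univ.image f₄)
  -- all the inequalities are tight
  have hinj : ∀ g : Fin 3 → α, (Finset.univ.image g).card = 3 → Set.InjOn g ↑(Finset.univ : Finset (Fin 3)) :=
    fun g hg => Finset.card_image_iff.1 (by rw [hg]; simp)
  have i₁ := hinj f₁ (by omega); have i₂ := hinj f₂ (by omega)
  have i₃ := hinj f₃ (by omega); have i₄ := hinj f₄ (by omega)
  have d1 : Disjoint (Finset.univ.image f₁) (Finset.univ.image f₂) :=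
    Finset.card_union_eq_card_add_card.1 (by omega)
  have d2 : Disjoint (Finset.univ.image f₁ ∪ Finset.univ.image f₂) (Finset.univ.image f₃) :=
    Finset.card_union_eq_card_add_card.1 (by omega)
  have d3 : Disjoint (Finset.univ.image f₁ ∪ Finset.univ.image f₂ ∪ Finset.univ.image f₃)
      (Finset.univ.image f₄) := Finset.card_union_eq_card_add_card.1 (by omega)
  have himg : ∀ g : Fin 3 → α, Set.InjOn g ↑(Finset.univ : Finset (Fin 3)) →
      ((Finset.univ.image g).filter P).card = (Finset.univ.filter fun m => P (g m)).card := by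
    intro g hg
    rw [Finset.filter_image, Finset.card_image_of_injOn (hg.mono (by simp))]
  rw [Finset.filter_union, Finset.card_union_of_disjoint
      (d3.mono (Finset.filter_subset _ _) (Finset.filter_subset _ _)),
    Finset.filter_union, Finset.card_union_of_disjoint
      (d2.mono (Finset.filter_subset _ _) (Finset.filter_subset _ _)),
    Finset.filter_union, Finset.card_union_of_disjoint
      (d1.mono (Finset.filter_subset _ _) (Finset.filter_subset _ _)),
    himg f₁ i₁, himg f₂ i₂, himg f₃ i₃, himg f₄ i₄]

open scoped Classical in
/-- The twelve neighbour positions of a ball of a Barlow configuration are pairwise distinct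
(the four families of three form a `12`-element set). -/
theorem card_twelve_vectors {σ : ℤ → ℤ} (hσ : IsHaggSeq σ) {N : ℕ}
    (x : Fin N → EuclideanSpace ℝ (Fin 3)) (hmem : ∀ i, x i ∈ barlowStacking 1 (Real.sqrt (2 / 3)) σ)
    (i : Fin N) (k : ℤ) (hk : x i 2 = k * Real.sqrt (2 / 3)) :
    ((Finset.univ.image fun m : Fin 3 => x i + WithLp.toLp 2 (aVec m)) ∪
        (Finset.univ.image fun m : Fin 3 => x i - WithLp.toLp 2 (aVec m)) ∪
        (Finset.univ.image fun m : Fin 3 =>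
          x i + WithLp.toLp 2 (if σ k = 1 then bPlus m else bMinus m)) ∪
        (Finset.univ.image fun m : Fin 3 =>
          x i - WithLp.toLp 2 (if σ (k - 1) = 1 then bPlus m else bMinus m))).card = 12 := by
  obtain ⟨k', a, b, hxi⟩ := hmem i
  have hH : Real.sqrt (2 / 3) ≠ 0 := (Real.sqrt_pos.2 (by norm_num)).ne'
  have hk' : k' = k := by
    have h2 := hk
    rw [hxi, barlowPos_apply_two] at h2
    exact_mod_cast mul_right_cancel₀ hH h2
  subst hk'
  have hSset : {w | w ∈ barlowStacking 1 (Real.sqrt (2 / 3)) σ ∧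
      dist (barlowPos 1 (Real.sqrt (2 / 3)) σ k' a b) w = 1} =
      ↑((Finset.univ.image fun m : Fin 3 => x i + WithLp.toLp 2 (aVec m)) ∪
        (Finset.univ.image fun m : Fin 3 => x i - WithLp.toLp 2 (aVec m)) ∪
        (Finset.univ.image fun m : Fin 3 =>
          x i + WithLp.toLp 2 (if σ k' = 1 then bPlus m else bMinus m)) ∪
        (Finset.univ.image fun m : Fin 3 =>
          x i - WithLp.toLp 2 (if σ (k' - 1) = 1 then bPlus m else bMinus m))) := by
    ext w
    rw [Set.mem_setOf_eq, mem_touching_iff_twelve_vectors hσ k' a b w, ← hxi]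
    simp only [Finset.coe_union, Finset.coe_image, Finset.coe_univ, Set.image_univ, Set.mem_union,
      Set.mem_range, eq_comm, or_assoc]
  have := ncard_touching_barlowPos hσ one_pos sqrt_two_thirds_sq k' a b
  rwa [hSset, Set.ncard_coe_finset] at this

open scoped Classical in
/-- Exchange of summation: summing a layer-indexed quantity over the balls of the layers `k ∈ KS` is
summing over the balls whose layer lies in `KS`; hence it is at most the sum over all balls. -/
theorem sum_layers_le {N : ℕ} (kf : Fin N → ℤ) (KS : Finset ℤ) (g : ℤ → Fin N → ℕ) :
    ∑ k ∈ KS, ∑ i ∈ Finset.univ.filter (fun i => kf i = k), g k i ≤ ∑ i, g (kf i) i := by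
  have h : ∀ k ∈ KS, ∑ i ∈ Finset.univ.filter (fun i => kf i = k), g k i =
      ∑ i, if kf i = k then g (kf i) i else 0 := by
    intro k _
    rw [Finset.sum_filter]
    refine Finset.sum_congr rfl fun i _ => ?_
    by_cases hi : kf i = k
    · simp [hi]
    · simp [hi]
  rw [Finset.sum_congr rfl h, Finset.sum_comm]
  refine Finset.sum_le_sum fun i _ => ?_
  rw [Finset.sum_ite_eq KS (kf i)]
  split_ifs
  · exact le_rfl
  · exact Nat.zero_le _

open scoped Classical in
/-- **Unmatched centres per class are vacant slots.**  For an injective configuration `x` in the Barlow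
stacking of a Hägg word `σ` with layer map `kf` (`(x i)₂ = kf i · √(2/3)`), any finite set of layers `KS`:
summing over `k ∈ KS` and the three vectors `m` of each family, the unmatched centres of the in-layer
comparison `x(L_k) + aVec m` vs `x(L_k)` and of the gap comparison `x(L_k) + b_{σ k,m}` vs `x(L_{k+1})`
number at most `12 N − 2 · numContacts x` (`= 2D`). -/
theorem sum_classUnmatched_le {σ : ℤ → ℤ} (hσ : IsHaggSeq σ) {N : ℕ}
    (x : Fin N → EuclideanSpace ℝ (Fin 3)) (hx : Function.Injective x)
    (hmem : ∀ i, x i ∈ barlowStacking 1 (Real.sqrt (2 / 3)) σ) (kf : Fin N → ℤ)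
    (hkf : ∀ i, x i 2 = kf i * Real.sqrt (2 / 3)) (KS : Finset ℤ) :
    (∑ k ∈ KS, ∑ m : Fin 3,
      ((((Finset.univ.filter fun i => kf i = k).image fun i => x i + WithLp.toLp 2 (aVec m)) \
            ((Finset.univ.filter fun i => kf i = k).image x)).card +
        (((Finset.univ.filter fun i => kf i = k).image x) \
            ((Finset.univ.filter fun i => kf i = k).image fun i => x i + WithLp.toLp 2 (aVec m))).card +
        (((Finset.univ.filter fun i => kf i = k).image fun i =>
              x i + WithLp.toLp 2 (if σ k = 1 then bPlus m else bMinus m)) \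
            ((Finset.univ.filter fun i => kf i = k + 1).image x)).card +
        (((Finset.univ.filter fun i => kf i = k + 1).image x) \
            ((Finset.univ.filter fun i => kf i = k).image fun i =>
              x i + WithLp.toLp 2 (if σ k = 1 then bPlus m else bMinus m))).card)) +
      2 * Summit.Ventures.Crystal3D.numContacts x ≤ 12 * N := by
  have hH : Real.sqrt (2 / 3) ≠ 0 := (Real.sqrt_pos.2 (by norm_num)).ne'
  -- layer of a ball reached by a vector with third coordinate `t`
  have hlayer : ∀ i j : Fin N, ∀ v : Fin 3 → ℝ, x j = x i + WithLp.toLp 2 v →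
      (kf j : ℝ) * Real.sqrt (2 / 3) = kf i * Real.sqrt (2 / 3) + v 2 := by
    intro i j v h
    have := congrArg (fun z : EuclideanSpace ℝ (Fin 3) => z 2) h
    simp only [PiLp.add_apply] at this
    rw [hkf j, hkf i] at this
    exact this
  have haVec2 : ∀ m : Fin 3, aVec m 2 = 0 := fun m => by fin_cases m <;> simp [aVec]
  have hb2 : ∀ (s : ℤ) (m : Fin 3), (if s = 1 then bPlus m else bMinus m) 2 = Real.sqrt (2 / 3) := by
    intro s m
    split_ifs <;> fin_cases m <;> simp [bPlus, bMinus]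
  -- (1) in-layer, `P \ Q`
  have h1 : ∀ (k : ℤ) (m : Fin 3),
      (((Finset.univ.filter fun i => kf i = k).image fun i => x i + WithLp.toLp 2 (aVec m)) \
          ((Finset.univ.filter fun i => kf i = k).image x)).card ≤
        ((Finset.univ.filter fun i => kf i = k).filter
          fun i => x i + WithLp.toLp 2 (aVec m) ∉ Set.range x).card := by
    intro k m
    refine (Finset.card_le_card (t := ((Finset.univ.filter fun i => kf i = k).filter
      fun i => x i + WithLp.toLp 2 (aVec m) ∉ Set.range x).image
        fun i => x i + WithLp.toLp 2 (aVec m)) ?_).trans Finset.card_image_le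
    intro p hp
    rw [Finset.mem_sdiff, Finset.mem_image] at hp
    obtain ⟨⟨i, hi, rfl⟩, hnot⟩ := hp
    refine Finset.mem_image.2 ⟨i, Finset.mem_filter.2 ⟨hi, ?_⟩, rfl⟩
    rintro ⟨j, hj⟩
    apply hnot
    refine Finset.mem_image.2 ⟨j, Finset.mem_filter.2 ⟨Finset.mem_univ _, ?_⟩, hj⟩
    have := hlayer i j (aVec m) hj
    rw [haVec2, add_zero] at this
    have hik := (Finset.mem_filter.1 hi).2
    have : (kf j : ℝ) = kf i := mul_right_cancel₀ hH this
    have h' : kf j = kf i := by exact_mod_cast this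
    exact h'.trans hik
  -- (2) in-layer, `Q \ P`
  have h2 : ∀ (k : ℤ) (m : Fin 3),
      (((Finset.univ.filter fun i => kf i = k).image x) \
          ((Finset.univ.filter fun i => kf i = k).image fun i => x i + WithLp.toLp 2 (aVec m))).card ≤
        ((Finset.univ.filter fun i => kf i = k).filter
          fun i => x i - WithLp.toLp 2 (aVec m) ∉ Set.range x).card := by
    intro k m
    refine (Finset.card_le_card (t := ((Finset.univ.filter fun i => kf i = k).filter
      fun i => x i - WithLp.toLp 2 (aVec m) ∉ Set.range x).image x) ?_).trans Finset.card_image_le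
    intro q hq
    rw [Finset.mem_sdiff, Finset.mem_image] at hq
    obtain ⟨⟨i, hi, rfl⟩, hnot⟩ := hq
    refine Finset.mem_image.2 ⟨i, Finset.mem_filter.2 ⟨hi, ?_⟩, rfl⟩
    rintro ⟨j, hj⟩
    apply hnot
    have hj' : x i = x j + WithLp.toLp 2 (aVec m) := by rw [hj, sub_add_cancel]
    refine Finset.mem_image.2 ⟨j, Finset.mem_filter.2 ⟨Finset.mem_univ _, ?_⟩, hj'.symm⟩
    have := hlayer j i (aVec m) hj'
    rw [haVec2, add_zero] at this
    have hik := (Finset.mem_filter.1 hi).2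
    have : (kf i : ℝ) = kf j := mul_right_cancel₀ hH this
    have : kf i = kf j := by exact_mod_cast this
    omega
  -- (3) cross, `P \ Q`
  have h3 : ∀ (k : ℤ) (m : Fin 3),
      (((Finset.univ.filter fun i => kf i = k).image fun i =>
            x i + WithLp.toLp 2 (if σ k = 1 then bPlus m else bMinus m)) \
          ((Finset.univ.filter fun i => kf i = k + 1).image x)).card ≤
        ((Finset.univ.filter fun i => kf i = k).filter fun i =>
          x i + WithLp.toLp 2 (if σ (kf i) = 1 then bPlus m else bMinus m) ∉ Set.range x).card := by
    intro k m
    refine (Finset.card_le_card (t := ((Finset.univ.filter fun i => kf i = k).filter fun i =>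
      x i + WithLp.toLp 2 (if σ (kf i) = 1 then bPlus m else bMinus m) ∉ Set.range x).image
        fun i => x i + WithLp.toLp 2 (if σ k = 1 then bPlus m else bMinus m)) ?_).trans
      Finset.card_image_le
    intro p hp
    rw [Finset.mem_sdiff, Finset.mem_image] at hp
    obtain ⟨⟨i, hi, rfl⟩, hnot⟩ := hp
    have hik := (Finset.mem_filter.1 hi).2
    refine Finset.mem_image.2 ⟨i, Finset.mem_filter.2 ⟨hi, ?_⟩, rfl⟩
    rw [hik]
    rintro ⟨j, hj⟩
    apply hnot
    refine Finset.mem_image.2 ⟨j, Finset.mem_filter.2 ⟨Finset.mem_univ _, ?_⟩, hj⟩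
    have := hlayer i j _ hj
    rw [hb2] at this
    have : (kf j : ℝ) * Real.sqrt (2 / 3) = (kf i + 1) * Real.sqrt (2 / 3) := by rw [this]; ring
    have : (kf j : ℝ) = kf i + 1 := mul_right_cancel₀ hH this
    have : kf j = kf i + 1 := by exact_mod_cast this
    omega
  -- (4) cross, `Q \ P`
  have h4 : ∀ (k : ℤ) (m : Fin 3),
      (((Finset.univ.filter fun i => kf i = k + 1).image x) \
          ((Finset.univ.filter fun i => kf i = k).image fun i =>
            x i + WithLp.toLp 2 (if σ k = 1 then bPlus m else bMinus m))).card ≤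
        ((Finset.univ.filter fun i => kf i = k + 1).filter fun i =>
          x i - WithLp.toLp 2 (if σ (kf i - 1) = 1 then bPlus m else bMinus m) ∉ Set.range x).card := by
    intro k m
    refine (Finset.card_le_card (t := ((Finset.univ.filter fun i => kf i = k + 1).filter fun i =>
      x i - WithLp.toLp 2 (if σ (kf i - 1) = 1 then bPlus m else bMinus m) ∉ Set.range x).image x)
      ?_).trans Finset.card_image_le
    intro q hq
    rw [Finset.mem_sdiff, Finset.mem_image] at hq
    obtain ⟨⟨i, hi, rfl⟩, hnot⟩ := hq
    have hik := (Finset.mem_filter.1 hi).2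
    refine Finset.mem_image.2 ⟨i, Finset.mem_filter.2 ⟨hi, ?_⟩, rfl⟩
    rw [hik, add_sub_cancel_right]
    rintro ⟨j, hj⟩
    apply hnot
    have hj' : x i = x j + WithLp.toLp 2 (if σ k = 1 then bPlus m else bMinus m) := by
      rw [hj, sub_add_cancel]
    refine Finset.mem_image.2 ⟨j, Finset.mem_filter.2 ⟨Finset.mem_univ _, ?_⟩, hj'.symm⟩
    have := hlayer j i _ hj'
    rw [hb2] at this
    have : (kf i : ℝ) * Real.sqrt (2 / 3) = (kf j + 1) * Real.sqrt (2 / 3) := by rw [this]; ring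
    have : (kf i : ℝ) = kf j + 1 := mul_right_cancel₀ hH this
    have : kf i = kf j + 1 := by exact_mod_cast this
    omega
  -- per-ball vacancy counts of the four families
  set cA : Fin N → ℕ := fun i =>
    (Finset.univ.filter fun m : Fin 3 => x i + WithLp.toLp 2 (aVec m) ∉ Set.range x).card with hcA
  set cA' : Fin N → ℕ := fun i =>
    (Finset.univ.filter fun m : Fin 3 => x i - WithLp.toLp 2 (aVec m) ∉ Set.range x).card with hcA'
  set cB : Fin N → ℕ := fun i => (Finset.univ.filter fun m : Fin 3 =>
    x i + WithLp.toLp 2 (if σ (kf i) = 1 then bPlus m else bMinus m) ∉ Set.range x).card with hcB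
  set cB' : Fin N → ℕ := fun i => (Finset.univ.filter fun m : Fin 3 =>
    x i - WithLp.toLp 2 (if σ (kf i - 1) = 1 then bPlus m else bMinus m) ∉ Set.range x).card with hcB'
  -- assemble
  have htot := sum_vacant_add_two_mul_numContacts hσ x hx hmem kf hkf
  have hsplit : ∀ i : Fin N, (((Finset.univ.image fun m : Fin 3 => x i + WithLp.toLp 2 (aVec m)) ∪
        (Finset.univ.image fun m : Fin 3 => x i - WithLp.toLp 2 (aVec m)) ∪
        (Finset.univ.image fun m : Fin 3 =>
          x i + WithLp.toLp 2 (if σ (kf i) = 1 then bPlus m else bMinus m)) ∪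
        (Finset.univ.image fun m : Fin 3 =>
          x i - WithLp.toLp 2 (if σ (kf i - 1) = 1 then bPlus m else bMinus m))).filter
        fun w => w ∉ Set.range x).card = cA i + cA' i + cB i + cB' i := fun i =>
    card_filter_union_four _ _ _ _ _ (card_twelve_vectors hσ x hmem i (kf i) (hkf i))
  simp_rw [hsplit] at htot
  -- bound the class sum by the per-ball sums
  have hle : (∑ k ∈ KS, ∑ m : Fin 3,
      ((((Finset.univ.filter fun i => kf i = k).image fun i => x i + WithLp.toLp 2 (aVec m)) \
            ((Finset.univ.filter fun i => kf i = k).image x)).card +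
        (((Finset.univ.filter fun i => kf i = k).image x) \
            ((Finset.univ.filter fun i => kf i = k).image fun i => x i + WithLp.toLp 2 (aVec m))).card +
        (((Finset.univ.filter fun i => kf i = k).image fun i =>
              x i + WithLp.toLp 2 (if σ k = 1 then bPlus m else bMinus m)) \
            ((Finset.univ.filter fun i => kf i = k + 1).image x)).card +
        (((Finset.univ.filter fun i => kf i = k + 1).image x) \
            ((Finset.univ.filter fun i => kf i = k).image fun i =>
              x i + WithLp.toLp 2 (if σ k = 1 then bPlus m else bMinus m))).card)) ≤
      ∑ i, (cA i + cA' i + cB i + cB' i) := by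
    calc _ ≤ ∑ k ∈ KS, ((∑ i ∈ Finset.univ.filter (fun i => kf i = k), (cA i + cA' i + cB i)) +
          ∑ i ∈ Finset.univ.filter (fun i => kf i = k + 1), cB' i) := by
          refine Finset.sum_le_sum fun k _ => ?_
          have e1 : ∑ m : Fin 3, ((Finset.univ.filter fun i => kf i = k).filter
              fun i => x i + WithLp.toLp 2 (aVec m) ∉ Set.range x).card =
              ∑ i ∈ Finset.univ.filter (fun i => kf i = k), cA i := by
            simp only [hcA, Finset.card_filter]; exact Finset.sum_comm
          have e2 : ∑ m : Fin 3, ((Finset.univ.filter fun i => kf i = k).filter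
              fun i => x i - WithLp.toLp 2 (aVec m) ∉ Set.range x).card =
              ∑ i ∈ Finset.univ.filter (fun i => kf i = k), cA' i := by
            simp only [hcA', Finset.card_filter]; exact Finset.sum_comm
          have e3 : ∑ m : Fin 3, ((Finset.univ.filter fun i => kf i = k).filter fun i =>
              x i + WithLp.toLp 2 (if σ (kf i) = 1 then bPlus m else bMinus m) ∉ Set.range x).card =
              ∑ i ∈ Finset.univ.filter (fun i => kf i = k), cB i := by
            simp only [hcB, Finset.card_filter]; exact Finset.sum_comm
          have e4 : ∑ m : Fin 3, ((Finset.univ.filter fun i => kf i = k + 1).filter fun i =>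
              x i - WithLp.toLp 2 (if σ (kf i - 1) = 1 then bPlus m else bMinus m) ∉ Set.range x).card =
              ∑ i ∈ Finset.univ.filter (fun i => kf i = k + 1), cB' i := by
            simp only [hcB', Finset.card_filter]; exact Finset.sum_comm
          have b1 := (Finset.sum_le_sum fun m (_ : m ∈ (Finset.univ : Finset (Fin 3))) => h1 k m).trans
            e1.le
          have b2 := (Finset.sum_le_sum fun m (_ : m ∈ (Finset.univ : Finset (Fin 3))) => h2 k m).trans
            e2.le
          have b3 := (Finset.sum_le_sum fun m (_ : m ∈ (Finset.univ : Finset (Fin 3))) => h3 k m).trans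
            e3.le
          have b4 := (Finset.sum_le_sum fun m (_ : m ∈ (Finset.univ : Finset (Fin 3))) => h4 k m).trans
            e4.le
          simp only [Finset.sum_add_distrib]
          exact add_le_add (add_le_add (add_le_add b1 b2) b3) b4
      _ ≤ ∑ i, (cA i + cA' i + cB i) + ∑ i, cB' i := by
          rw [Finset.sum_add_distrib]
          refine add_le_add (sum_layers_le kf KS fun _ i => cA i + cA' i + cB i) ?_
          have := sum_layers_le kf (KS.image fun k => k + 1) fun _ i => cB' i
          rw [Finset.sum_image fun a _ b _ h => by simpa using h] at this
          exact this
      _ = ∑ i, (cA i + cA' i + cB i + cB' i) := by rw [← Finset.sum_add_distrib]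
  omega

end Summit.Ventures.Crystal3D.Theorems

end
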